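import Summits.BirchSwinnertonDyer.BirchSwinnertonDyer.Theses.QuadraticBranchSignedControl
import Summits.BirchSwinnertonDyer.BirchSwinnertonDyer.Theorems.QuadraticBranchSignedControlEtaTransportSelmerMapOfLayers
import Summits.BirchSwinnertonDyer.BirchSwinnertonDyer.Theorems.QuadraticBranchSignedControlEtaTransportSelmerComparisonOfMap
import Summits.BirchSwinnertonDyer.BirchSwinnertonDyer.Theorems.QuadraticBranchSignedControlEtaTransportFrameAOfSelmerComparison
import Summits.BirchSwinnertonDyer.BirchSwinnertonDyer.Theorems.QuadraticBranchSignedControlEtaTransportSelmerAdicModel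
import Summits.BirchSwinnertonDyer.BirchSwinnertonDyer.Theorems.QuadraticBranchSignedControlEtaTransportLocalModelChangeSelmer
import Summits.BirchSwinnertonDyer.BirchSwinnertonDyer.Theorems.QuadraticBranchSignedControlEtaTransportDecompositionOfFrames
import Summits.BirchSwinnertonDyer.BirchSwinnertonDyer.Theorems.QuadraticBranchSignedControlEtaTransportOfThm74Fact
import HarnessLib

/-!
# Route `QuadraticBranchSignedControl` (rung K8, cell `bsd-potss`): the GLUE item
# `EtaTransportSignedOfLayerComparison` (stmt-BirchSwinnertonDyer-19585) of the gen-1 split of the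
# crux `EtaTransportSigned` (stmt-BirchSwinnertonDyer-19115) — PROVED (pure composition)

WHAT. The planner split the crux `EtaTransportSigned` (MC±_η, the η-component forms of Kobayashi's
signed main conjectures for the good supersingular twist `V`) into its open mathematics
`EtaLayerComparison` (item 19583 = the layer-level local-conditions comparison `hLayer`, ctrl's (i-c)
at the finite layers), the held published input `PublishedInputThm74` (item 19584 = Kobayashi 2003
Thm. 7.4 (ii) ⟺ (iii) at `η`, the tree's named fact `Kobayashi2003.thm74_etaEvenMC_iff_etaOddMC`)
and this glue `EtaLayerComparison → PublishedInputThm74 → EtaTransportSigned`. The glue is the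
kernel chain landed by seat `bsd-potss-k8q-c3` g0, composed in one term:
`hLayer ⟹ hMap` (`selmerMap_of_layerMaps`, unions over the layers) `⟹ hSel`
(`selmerComparison_of_map_eq`, the Γ-equivariant additive isomorphism) `⟹ hA`
(`frameA_of_selmerComparison`, the admissible quadratic model `F = ℚ(√p*) ⊂ ℚ(μ_p)` produced)
`⟹ hdec` (`etaDecomposition_of_frames` with frame (i-f) discharged, = `etaDecomposition_of_frameA`)
`⟹ EtaTransportSigned` (`etaTransportSigned_of_decomposition_of_thm74Fact`, plus stub by the
Λ-algebra of characteristic ideals, minus stub by Thm. 7.4 at `η`).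

NOTE. The step `hA ⟹ hdec` is `etaDecomposition_of_frameA` of the accepted file
`…EtaTransportDecompositionOfFrameA.lean` (p427212); that module has no olean on the farm at the
time of writing, so its two-line content (frame (i-f) = `…_adicCompletion` ∘ `…_adicCompletion_eq_padic`,
then `etaDecomposition_of_frames`) is re-derived inline inside the proof instead of imported.

HONEST FRAMING (cell `bsd-potss`, run/shared/lean/pub/bsd-potss/; FULL-BSD rank ≤ 1 programme):
this file closes the GLUE LEAF 19585 only («closes rung-internal glue of K8 of BirchSwinnertonDyer»);
it proves an implication whose antecedents `EtaLayerComparison` (open mathematics) and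
`PublishedInputThm74` (a deep published theorem, held cite-level) are NOT proved here; the crux
`EtaTransportSigned` itself stays open until 19583 is proved; BSD is not proved by any of this and
`BSD(W, p)` is claimed for no pair. No definition, no named fact introduced, no `sorry`, axioms
standard. Seat `bsd-potss-k8q-c3` (prover), g2.

References: [Kobayashi2003] Def. 1.1 (p. 2), Def. 2.1 (p. 5), §4 p. 8, Thm. 7.4 (p. 13);
[GreenbergLNM1716] §3.
-/

set_option autoImplicit false
set_option linter.dupNamespace false

noncomputable section

open scoped Classical

open NumberField IsDedekindDomain
open Literature.NumberTheory.EllipticCurves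
open Summit.BirchSwinnertonDyer.Rank1Residual.Additive

namespace Summit.BirchSwinnertonDyer.BirchSwinnertonDyer.Theorems

/-- **Glue item stmt-BirchSwinnertonDyer-19585 BY NAME**: `EtaLayerComparison → PublishedInputThm74 →
EtaTransportSigned`, by composing seat k8q-c3's landed chain
`hLayer ⟹ hMap ⟹ hSel ⟹ hA ⟹ hdec ⟹ (+ Thm. 7.4 at η) EtaTransportSigned`. Pure logic over the
imported theorems; the antecedents are hypotheses, not claims.
[cite: Kobayashi2003, Def. 1.1 (p. 2), Def. 2.1 (p. 5), §4 p. 8, Thm. 7.4 (p. 13)] -/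
theorem etaTransportSignedOfLayerComparison_proof :
    Summit.BirchSwinnertonDyer.BirchSwinnertonDyer.Theses.QuadraticBranchSignedControl.EtaTransportSignedOfLayerComparison := by
  unfold Theses.QuadraticBranchSignedControl.EtaTransportSignedOfLayerComparison
    Theses.QuadraticBranchSignedControl.EtaLayerComparison
    Theses.QuadraticBranchSignedControl.PublishedInputThm74
  intro hL h74
  -- frame (i-f) `Kobayashi2003.signedSelmerInfty V κ 1 = strictSignedSelmerInfty V κ ℚ_[p] 1`
  -- (= `signedSelmerInfty_one_eq_strictSignedSelmerInfty_padic` of `…DecompositionOfFrameA.lean`,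
  -- re-derived inline: a place `v₀` of `ℚ` above `p`, then `…_adicCompletion` and `…_eq_padic`)
  have hIF : ∀ (p : ℕ) [Fact p.Prime] (V : WeierstrassCurve ℚ) (κ : ZpExtension ℚ p),
      Kobayashi2003.signedSelmerInfty V κ 1 = strictSignedSelmerInfty V κ ℚ_[p] 1 := by
    intro p _ V κ
    have hpP : p.Prime := Fact.out
    obtain ⟨v₀, hv₀⟩ : ∃ v : HeightOneSpectrum (𝓞 ℚ), ((p : ℕ) : 𝓞 ℚ) ∈ v.asIdeal := by
      have hnu : ¬ IsUnit ((p : ℕ) : 𝓞 ℚ) := by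
        intro h
        have h' := h.map Rat.ringOfIntegersEquiv
        rw [map_natCast, Int.isUnit_iff_natAbs_eq, Int.natAbs_natCast] at h'
        exact hpP.one_lt.ne' h'
      obtain ⟨M, hM, hle⟩ := Ideal.exists_le_maximal (Ideal.span {((p : ℕ) : 𝓞 ℚ)})
        (by rwa [Ne, Ideal.span_singleton_eq_top])
      have hpM : ((p : ℕ) : 𝓞 ℚ) ∈ M := hle (Ideal.mem_span_singleton_self _)
      refine ⟨⟨M, hM.isPrime, fun hbot => ?_⟩, hpM⟩
      rw [hbot, Ideal.mem_bot] at hpM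
      exact hpP.ne_zero (by exact_mod_cast hpM)
    rw [signedSelmerInfty_one_eq_strictSignedSelmerInfty_adicCompletion V κ v₀ hv₀,
      strictSignedSelmerInfty_one_adicCompletion_eq_padic V κ v₀ hv₀]
  exact etaTransportSigned_of_decomposition_of_thm74Fact
    (etaDecomposition_of_frames (frameA_of_selmerComparison
        (selmerComparison_of_map_eq (selmerMap_of_layerMaps hL)))
      fun p _ _ V _ _ _ _ κ _ => hIF p V κ) h74

end Summit.BirchSwinnertonDyer.BirchSwinnertonDyer.Theorems

end
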